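import Mathlib
import Summits.Ventures.PercRepro2.Defs
import Summits.Ventures.PercRepro2.Graph
import Summits.Ventures.PercRepro2.OneColourSwitch
import Summits.Ventures.PercRepro2.RegionHubSign
import Summits.Ventures.PercRepro2.SideSwitch
import Summits.Ventures.PercRepro2.M9NoPocketDefs
import Summits.Ventures.PercRepro2.M9Unreached
import Summits.Ventures.PercRepro2.M9GeneralDSingleRoot

/-!
# The general single-`d` statement when the rooted neighbours of `d` form a clique (blind cell
PercRepro2, p3 g25, 2026-08-28; `proofs/P3-GENERALD.md` §7(b))

`M9GeneralDSingleRoot` handles a non-mark `d` with a single rooted neighbour.  The argument only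
needs that two rooted neighbours of `d` can never lie on opposite sides of the worlds of `G − d`:
if the rooted neighbours of `d` are pairwise ADJACENT (a clique, none of them `r` or `s`), then a
`Y`-edge `d–y` with `y` in the `Y`-world of `G − d` and a `W`-edge `d–y′` with `y′` in its
`W`-world force `y`, `y′` into both worlds of `G` through the edge `y–y′` (or `y = y′`),
contradicting `DOne` (`not_both_of_cliqueRoot`).  So `d` is never doubly reached and
`dSignSum ≤ 0` (`dSignSum_nonpos_of_cliqueRoot`).  Own work; std axioms.
-/

namespace Summit.Ventures.PercRepro2

namespace NoPocket

open Finset Classical RegionHub OneColourSwitch SideSwitch TermSwitch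

variable {V : Type*} {E : Type*}

section Root

variable {ends : E → Sym2 V} {r s d : V}

/-- `y` is rooted: joined to `r` or `s` by a path of `G − d`. -/
def Rooted (ends : E → Sym2 V) (r s d y : V) : Prop :=
  Conn (endsD ends d) (fun _ => true) y r ∨ Conn (endsD ends d) (fun _ => true) y s

/-- **The clique-root hypothesis**: the rooted neighbours of `d` are not `r, s`, and any two of
them are equal or adjacent. -/
def CliqueRoot (ends : E → Sym2 V) (r s d : V) : Prop :=
  (∀ e y, ends e = s(d, y) → y ≠ d → Rooted ends r s d y → y ≠ r ∧ y ≠ s) ∧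
    ∀ e y e' y', ends e = s(d, y) → ends e' = s(d, y') → y ≠ d → y' ≠ d →
      Rooted ends r s d y → Rooted ends r s d y' → y ≠ y' → ∃ e'', ends e'' = s(y, y')

/-- Under the clique-root hypothesis a `DOne` colouring never has `d` in both worlds. -/
lemma not_both_of_cliqueRoot (hr : d ≠ r) (hs : d ≠ s) (hc : CliqueRoot ends r s d)
    {ω : Config E} (hD : DOne ends r s d ω) :
    ¬ (d ∈ K2 ends r s ω ∧ d ∈ M2 ends r s ω) := by
  rintro ⟨hK, hM⟩
  obtain ⟨e, y, hends, _, hy⟩ := exists_open_edge_of_mem_K2 hr hs hK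
  obtain ⟨e', y', hends', _, hy'⟩ := exists_closed_edge_of_mem_M2 hr hs hM
  have hyd : y ≠ d := by
    rintro rfl
    exact not_mem_K2_endsD hr hs ω hy
  have hyd' : y' ≠ d := by
    rintro rfl
    exact not_mem_K2_endsD hr hs (OneColourSwitch.compl ω) hy'
  have hry : Rooted ends r s d y := rooted_of_mem_K2_endsD hy
  have hry' : Rooted ends r s d y' := rooted_of_mem_M2_endsD hy'
  obtain ⟨hyr, hys⟩ := hc.1 e y hends hyd hry
  obtain ⟨hyr', hys'⟩ := hc.1 e' y' hends' hyd' hry'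
  have hyK : y ∈ K2 ends r s ω := mem_K2_of_mem_K2_endsD hy
  have hyM' : y' ∈ M2 ends r s ω := mem_M2_of_mem_M2_endsD hy'
  by_cases hyy : y = y'
  · subst hyy
    exact hD y hyr hys hyd hyK hyM'
  · obtain ⟨e'', hends''⟩ := hc.2 e y e' y' hends hends' hyd hyd' hry hry' hyy
    cases he'' : ω e'' with
    | true =>
      -- `y'` is `Y`-adjacent to `y ∈ K₂`, hence in `K₂`; it is in `M₂` already.
      have hadj : OpenAdj ends ω y y' := ⟨e'', he'', hends''⟩
      have hyK' : y' ∈ K2 ends r s ω := by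
        rw [mem_K2_iff] at hyK ⊢
        rcases hyK with h | h
        · exact Or.inl (conn_trans h (conn_of_openAdj hadj))
        · exact Or.inr (conn_trans h (conn_of_openAdj hadj))
      exact hD y' hyr' hys' hyd' hyK' hyM'
    | false =>
      -- `y` is `W`-adjacent to `y' ∈ M₂`, hence in `M₂`; it is in `K₂` already.
      have hadj : OpenAdj ends (OneColourSwitch.compl ω) y' y :=
        ⟨e'', by simp [OneColourSwitch.compl, he''], by rw [hends'', Sym2.eq_swap]⟩
      have hyM : y ∈ M2 ends r s ω := by
        rw [mem_M2_iff] at hyM' ⊢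
        rcases hyM' with h | h
        · exact Or.inl (conn_trans h (conn_of_openAdj hadj))
        · exact Or.inr (conn_trans h (conn_of_openAdj hadj))
      exact hD y hyr hys hyd hyK hyM

end Root

section Sum

variable [Fintype V] [DecidableEq V] [Fintype E] [DecidableEq E] {ends : E → Sym2 V}
  {p q r s d : V}

/-- **The general single-`d` statement whenever `d` is never doubly reached**: with no
doubly reached point the single-`d` sum is the unreached part plus the reached `DZero` part,
both non-positive. -/
theorem dSignSum_nonpos_of_not_both (hnot : ∀ ω : Config E, DOne ends r s d ω →
    ¬ (d ∈ K2 ends r s ω ∧ d ∈ M2 ends r s ω)) : dSignSum ends p q r s d ≤ 0 := by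
  rw [dSignSum_eq_unreached_add_reached hnot]
  have h1 := unreachedSum_nonpos (ends := ends) (p := p) (q := q) (r := r) (s := s) (d := d)
  have h2 := reachedDZeroSum_nonpos (ends := ends) (p := p) (q := q) (r := r) (s := s) (d := d)
  linarith

/-- **The general single-`d` statement when the rooted neighbours of `d` form a clique** (none of
them `r` or `s`; the other neighbours of `d` arbitrary): `dSignSum ≤ 0`. -/
theorem dSignSum_nonpos_of_cliqueRoot (hr : d ≠ r) (hs : d ≠ s) (hc : CliqueRoot ends r s d) :
    dSignSum ends p q r s d ≤ 0 :=
  dSignSum_nonpos_of_not_both fun _ hD => not_both_of_cliqueRoot hr hs hc hD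

omit [Fintype V] [DecidableEq V] [Fintype E] [DecidableEq E] in
/-- A single rooted neighbour is a clique: the single-root theorem is a special case. -/
lemma cliqueRoot_of_singleRoot {x : V} (hxr : x ≠ r) (hxs : x ≠ s)
    (hx : SingleRoot ends r s d x) : CliqueRoot ends r s d := by
  refine ⟨fun e y hends hyd hry => ?_, fun e y e' y' hends hends' hyd hyd' hry hry' hyy => ?_⟩
  · have := hx e y hends hyd hry
    subst this
    exact ⟨hxr, hxs⟩
  · exact absurd ((hx e y hends hyd hry).trans (hx e' y' hends' hyd' hry').symm) hyy

end Sum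

end NoPocket

end Summit.Ventures.PercRepro2
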